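import Mathlib
import Summits.KontsevichZagierPeriods.Zeta5Search.ThirdOrderAggregate
import Summits.KontsevichZagierPeriods.Zeta5Search.ZeroWindowKit
import HarnessLib

/-!
# ζ(5) search — THEOREM A⁗♭ (A⁗ with a FLAT sub-sub-deep layer): the palindromic pair at exponent `m + 2` (`pal_pair₃`, `flat_pair₃`)

Cell `pub-zeta5` (HONEST FRAMING: systematic search; no irrationality claim unless certified), TRACK «DENOM-LAW» D1, prover seat
`denom-prover-d1` generation 20 (`HOME/denom-law/prover-d1/ATTEMPT-20.md`).  `p`-adic valuation bookkeeping of the cell's OWN rationals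
(class pieces `W_x`, `V_x` of the Brown–Zudilin dual coefficients); nothing about ζ(5); no model exponent; records in print UNMOVED.

THE ONE NEW STEP.  THEOREM A⁗ (`SecondOrder.lawA4_holds`, `7 − 2M`) asks (clause (T3), `H5`) that every pole class with `ν = −M + 2` be an
admissible DOUBLE RAISE of the deep type `T`; the census of the ∀-`b` node (`DenomLaw.PathAccountingFirstPeriod`, ATTEMPT-18 §3 (iii)) found its
largest open configuration to be exactly A⁗'s frame with, in addition, a conjugate pair of FOREIGN single-pole classes of palindromic type
(`[0,−6,0]`) at `ν = −M + 2` (e.g. `b = (15;7,7,4,4,2,2,0)`, `p = 7`, `M = 8`: `v₇(Cas₇) = −9 = 7 − 2M`, casLB = −11).  Such a pair contributes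
NOTHING at relative order `p²`: for a pole class `z` of PALINDROMIC type list and even exponent `E = m + 2` (`m = −M`), the class is centre-free
(`selfConjugateOdd_holds`), `ŵ_z = ŵ_z̄ = 0` and `v̂_z̄ = v̂_z` (`deep_data`, the conjugate class carrying the same list, `ZeroWindows.classTypeList_conj`),
and `ĝ_z̄ ≡ −ĝ_z (mod p)` (`gHat_pair_even_first`); with the order-`m+2` digit estimates `subsub3W_norm` / `subsub3V_norm` this gives
`(Ω,N)_z + (Ω,N)_z̄ ≡ 0 (mod p³)` (`pal_pair₃`); `flat_pair₃` is the sub-sub-deep pair under the FLAT clause (T3♭) «every pole class with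
`ν = −M+2` is an admissible double raise of `T` OR has a palindromic type list» (`double_pair₃` or `pal_pair₃`).  The law itself
(`lawA4_flat`, `7 − 2M`: the tree's `pair₃` / `aggregate₄` / `lawA4_holds` with `flat_pair₃` for `double_pair₃`) is `Zeta5Search/LawA4Flat.lean`,
after the transport of (T3♭) to `b + e_j` (`ThirdOrderFlatTransfer.lean`).
-/

noncomputable section

open Finset PowerSeries

namespace Summit.KontsevichZagierPeriods.Zeta5Search.SecondOrder

open Summit.KontsevichZagierPeriods.Zeta5Search.DualSeries (InBox)
open Summit.KontsevichZagierPeriods.Zeta5Search.WedgeDictionary (coeffW coeffV)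
open Summit.KontsevichZagierPeriods.Zeta5Search.CasoratianValuation (InPolytope)
open Summit.KontsevichZagierPeriods.Zeta5Search.ClusterValuation
open Summit.KontsevichZagierPeriods.Zeta5Search.PadicSeries
open Summit.KontsevichZagierPeriods.Zeta5Search.CellA (classW coeffW_eq_sum_classW padicNorm_p padicNorm_pow_eq)
open Summit.KontsevichZagierPeriods.Zeta5Search.BigPrime (padicNorm_mul_le_one)
open Summit.KontsevichZagierPeriods.Zeta5Search.CellKit (conj_level)
open Summit.KontsevichZagierPeriods.Zeta5Search.ZeroWindows (classTypeList_conj)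

variable {p : ℕ} [hp : Fact p.Prime]

/-! ## §1 The palindromic pair at exponent `m + 2` contributes nothing (mod `p³`) -/

section PalPair

variable (b : ℕ → ℤ) (hb : InPolytope b) (hp5 : 5 ≤ p) (hpn : (p : ℤ) ≤ b 0) (hwin : (b 0 + 2 : ℤ) < (p : ℤ) ^ 2)
  (T : List ℤ) {z : ℕ} (hz : z < p) (hpole : 1 ≤ classPoleCount b p z)
  {m : ℤ} (hme : Even m) (hE : classExp b p z = m + 2)
  (hpal : (classTypeList b p z).reverse = classTypeList b p z)
include hb hp5 hpn hwin hz hpole hme hE hpal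

/-- **The PALINDROMIC PAIR at exponent `m + 2`**: a pole class `z` with palindromic type list and `E_z = m + 2` (`m` even) satisfies
`(Ω,N)_z + (Ω,N)_z̄ ≡ 0 (mod p³)` — stated in the shape of `double_pair₃` with the scalar `a = 0` (so for ANY list `T`). -/
theorem pal_pair₃ :
    ∃ a : ℚ, (padicNorm p (a * typeTauW (tTop T) (tList T)) ≤ (p : ℚ) ^ (-(1 : ℤ)) ∧
        padicNorm p (a * typeTauV (tTop T) (tList T)) ≤ (p : ℚ) ^ (-(1 : ℤ))) ∧
      padicNorm p (classW b p z / (-(p : ℚ)) ^ (m + 3) + classW b p (conjClass b p z) / (-(p : ℚ)) ^ (m + 3)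
        - a * typeTauW (tTop T) (tList T)) ≤ (p : ℚ) ^ (-(3 : ℤ)) ∧
      padicNorm p (classV b p z / (-(p : ℚ)) ^ m + classV b p (conjClass b p z) / (-(p : ℚ)) ^ m
        - a * typeTauV (tTop T) (tList T)) ≤ (p : ℚ) ^ (-(3 : ℤ)) := by
  have h0 : 0 ≤ b 0 := hb.1.1
  have hp0 : (p : ℚ) ≠ 0 := Nat.cast_ne_zero.2 hp.out.ne_zero
  have hp2 : p ≠ 2 := by omega
  obtain ⟨-, -, -, hn⟩ := thmA_data b hb hwin
  have hzn := le_b0_of_lt b hpn hz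
  obtain ⟨hL, hL'⟩ := level_bounds' (p := p) b hzn
  have hEc : classExp b p (conjClass b p z) = m + 2 := by rw [classExp_conj b h0 hzn]; exact hE
  have hpolec : 1 ≤ classPoleCount b p (conjClass b p z) := by rw [classPoleCount_conj b h0 hzn]; exact hpole
  obtain ⟨hz', -, -⟩ := conj_level b hz hL hL'
  have heven : Even (classExp b p z) := by rw [hE]; exact hme.add (by decide : Even (2 : ℤ))
  have hodd : Odd (3 + classExp b p z) := by obtain ⟨r, hr⟩ := heven; exact ⟨r + 1, by omega⟩
  -- both classes are centre-free (their exponent is even)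
  have hcz : ¬ CentreIn b p z := fun hcen =>
    (Int.not_odd_iff_even.2 heven) (selfConjugateOdd_holds b p z hb hp.out hp5 hz hpole hcen)
  have hevenc : Even (classExp b p (conjClass b p z)) := by rw [classExp_conj b h0 hzn]; exact heven
  have hoddc : Odd (3 + classExp b p (conjClass b p z)) := by rw [classExp_conj b h0 hzn]; exact hodd
  have hcc : ¬ CentreIn b p (conjClass b p z) := fun hcen =>
    (Int.not_odd_iff_even.2 hevenc) (selfConjugateOdd_holds b p _ hb hp.out hp5 hz' hpolec hcen)
  -- the conjugate class carries the same (palindromic) type list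
  have htlc : classTypeList b p (conjClass b p z) = classTypeList b p z := by
    rw [classTypeList_conj b h0 hz hL hL', hpal]
  -- `ŵ = 0` on both classes, `v̂_z̄ = v̂_z`
  obtain ⟨hw0, -, -, hvc⟩ := deep_data b hb hpn hpal hz hcz rfl hodd
  obtain ⟨hw0c, -, -, -⟩ := deep_data b hb hpn hpal hz' hcc htlc hoddc
  -- the order-`m+2` digit estimates
  have hWz := subsub3W_norm b hb hp5 hwin hz hpole hE
  have hWc := subsub3W_norm b hb hp5 hwin hz' hpolec hEc
  have hVz := subsub3V_norm b hb hp5 hwin hz hpole hE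
  have hVc := subsub3V_norm b hb hp5 hwin hz' hpolec hEc
  rw [hw0, mul_zero, mul_zero, sub_zero] at hWz
  rw [hw0c, mul_zero, mul_zero, sub_zero] at hWc
  rw [hvc] at hVc
  have hgg := gHat_pair_even_first b hb hp5 hz hL hL' hcz heven
  have hv1 : padicNorm p (vHat b p z) ≤ 1 := LevelClass.padicNorm_vHat_le_one b h0 hn hp2
  refine ⟨0, ⟨by rw [zero_mul, padicNorm.zero]; exact zpow_p_nonneg _,
    by rw [zero_mul, padicNorm.zero]; exact zpow_p_nonneg _⟩, ?_, ?_⟩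
  · rw [zero_mul, sub_zero]
    exact (padicNorm.nonarchimedean (p := p)).trans (max_le hWz hWc)
  · rw [zero_mul, sub_zero]
    have e : classV b p z / (-(p : ℚ)) ^ m + classV b p (conjClass b p z) / (-(p : ℚ)) ^ m =
        (classV b p z / (-(p : ℚ)) ^ m - (p : ℚ) ^ 2 * (gHat b p z * vHat b p z))
        + (classV b p (conjClass b p z) / (-(p : ℚ)) ^ m - (p : ℚ) ^ 2 * (gHat b p (conjClass b p z) * vHat b p z))
        + (p : ℚ) ^ 2 * ((gHat b p (conjClass b p z) + gHat b p z) * vHat b p z) := by ring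
    rw [e]
    refine (padicNorm.nonarchimedean (p := p)).trans
      (max_le ((padicNorm.nonarchimedean (p := p)).trans (max_le hVz hVc)) ?_)
    exact (padicNorm_p_pow_mul_le 2 (padicNorm_mul_le_left hgg hv1)).trans
      (le_of_eq (by rw [← zpow_add₀ hp0]; norm_num))

end PalPair

/-- **The sub-sub-deep pair under the FLAT clause**: an admissible double raise of `T` (`double_pair₃`) or a palindromic list (`pal_pair₃`). -/
theorem flat_pair₃ (b : ℕ → ℤ) (hb : InPolytope b) (hp5 : 5 ≤ p) (hpn : (p : ℤ) ≤ b 0) (hwin : (b 0 + 2 : ℤ) < (p : ℤ) ^ 2)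
    {T : List ℤ} (hT : T.reverse = T) {z : ℕ} (hz : z < p) (hpole : 1 ≤ classPoleCount b p z)
    {m : ℤ} (hme : Even m) (hE : classExp b p z = m + 2) (hm : m + 2 ≤ -2)
    (h : isRaise2 T (classTypeList b p z) = true ∨ (classTypeList b p z).reverse = classTypeList b p z) :
    ∃ a : ℚ, (padicNorm p (a * typeTauW (tTop T) (tList T)) ≤ (p : ℚ) ^ (-(1 : ℤ)) ∧
        padicNorm p (a * typeTauV (tTop T) (tList T)) ≤ (p : ℚ) ^ (-(1 : ℤ))) ∧
      padicNorm p (classW b p z / (-(p : ℚ)) ^ (m + 3) + classW b p (conjClass b p z) / (-(p : ℚ)) ^ (m + 3)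
        - a * typeTauW (tTop T) (tList T)) ≤ (p : ℚ) ^ (-(3 : ℤ)) ∧
      padicNorm p (classV b p z / (-(p : ℚ)) ^ m + classV b p (conjClass b p z) / (-(p : ℚ)) ^ m
        - a * typeTauV (tTop T) (tList T)) ≤ (p : ℚ) ^ (-(3 : ℤ)) := by
  rcases h with hr | hpal
  · exact double_pair₃ b hb hp5 hpn hwin hT hz hpole hme hE hm hr
  · exact pal_pair₃ b hb hp5 hpn hwin T hz hpole hme hE hpal

end Summit.KontsevichZagierPeriods.Zeta5Search.SecondOrder

end
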